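import Summits.BirchSwinnertonDyer.Uniform.UI.O2SigmaNormalisation
import Summits.BirchSwinnertonDyer.Rank1Residual.GaloisImage.PadicThreeSquareClass
import Literature.NumberTheory.EllipticCurves.KramerTwoDescentSquares
import HarnessLib

/-!
# Uniform/UI/O2 — `den x(P)` is a perfect square; `num x(P) ≡ 1 (mod 3)` when `3 ∣ den x(P)`

HONEST FRAMING (cell `bsd-uniform`, seat `ui-o2`, gen 8): THEOREMS ONLY — two facts about rational affine
points of a globally minimal Weierstrass model over `ℚ`; no definition, no named fact, no `sorry`; nothing
here is about BSD, books anything or moves a census mark (PLAN D7). Second of three gen-8 files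
(`O2SigmaNormalisation` → this → `O2PrincipalUnit`); section numbers are shared.

* §4 **`den x(P) = e²` is a perfect square** for every rational affine point of a globally minimal `W`
  (`exists_den_eq_sq`): every prime exponent of `den x` is even, because `ℓ ∣ den x` forces
  `‖x‖_ℓ > 1` and `‖y‖_ℓ² = ‖x‖_ℓ³` (AEC VII.2.2 `3v(x) = 2v(y)`; tree `norm_sq_eq_norm_cube`), and a
  positive integer with even exponents is a square (tree `KramerTwoDescent.nat_exists_sq_of_even_padicValNat`).
  This is Stein–Wuthrich's `e(P)` and Mazur–Stein–Tate's `d = √den x(Q)`, so far obtained in the tree only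
  row by row (the certificate files' `have hden : x.den = (3 ^ K * e') ^ 2 := by …`).
* §5 at `p = 3`: **`num x(P) ≡ 1 (mod 3)`**
  (`‖x·den x − 1‖₃ < 1`, `norm_x_mul_den_sub_one_lt_one_three`) whenever `‖x(P)‖₃ > 1`: with `den x = e²`,
  `a = x e²` and `b = y e³` are `3`-adic units, `a³ = (x³/y²)·b²` with `x³/y² ≡ 1` (file 1, §3) and
  `b² ≡ 1`, and `a² ≡ 1` (unit squares are `≡ 1 (mod 3)`: tree `LocalTorsion3.norm_sq_sub_one_lt_one`), so
  `a = a³/a² ≡ 1`. (At a general odd `p` the same computation says only that `num x(P)` is a non-zero SQUARE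
  mod `p`.)

References: [SilvermanAEC2009] VII.2.2; [MazurSteinTate2006] §1 (p. 3), Alg. 3.4 (step 2); [SteinWuthrich2013] §4.1
(`e(P)²` the denominator of `x(P)`); [Serre1973] Ch. II §3.1 Prop. 7; write-up `HOME/ui/O2-CONJECTURE.md` §13.
-/

noncomputable section

open scoped Classical
open IsUltrametricDist
open WeierstrassCurve Literature.NumberTheory.EllipticCurves
open Literature.NumberTheory.EllipticCurves.SteinWuthrich2013

namespace Summit.BirchSwinnertonDyer.Uniform.UI.O2

variable {W : WeierstrassCurve ℚ}

/-! ### §4 `den x(P)` is a perfect square (all primes at once) -/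

/-- **`v_ℓ(den x(P))` is even at every prime `ℓ`** for a rational affine point `(x, y)` of a globally
minimal (hence `ℤ`-integral) `W`: if `ℓ ∣ den x` then `‖x‖_ℓ = ℓ^{v_ℓ(den x)} > 1` (`ℓ ∤ num x`) and
`‖y‖_ℓ² = ‖x‖_ℓ³` (tree `norm_sq_eq_norm_cube`, AEC VII.2.2 `3v(x) = 2v(y)`), so `3·v_ℓ(den x)` is even.
[cite: SilvermanAEC2009, VII.2.2] -/
theorem even_padicValNat_den [W.IsElliptic] [W.IsGloballyMinimal] {x y : ℚ}
    (hxy : W.toAffine.Nonsingular x y) (ℓ : ℕ) [hℓ : Fact ℓ.Prime] : Even (padicValNat ℓ x.den) := by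
  by_cases hdvd : ℓ ∣ x.den
  · have hnum : ¬ (ℓ : ℤ) ∣ x.num := by
      intro h
      have h1 : ℓ ∣ x.num.natAbs := Int.natCast_dvd.mp h
      have h2 : ℓ ∣ Nat.gcd x.num.natAbs x.den := Nat.dvd_gcd h1 hdvd
      rw [x.reduced] at h2
      exact hℓ.out.one_lt.ne' (Nat.dvd_one.mp h2)
    have hx0 : x ≠ 0 := by
      rintro rfl
      rw [Rat.den_zero, Nat.dvd_one] at hdvd
      exact hℓ.out.ne_one hdvd
    have hX0 : (x : ℚ_[ℓ]) ≠ 0 := by exact_mod_cast hx0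
    have hvx : (x : ℚ_[ℓ]).valuation = -(padicValNat ℓ x.den : ℤ) := by
      rw [Padic.valuation_ratCast, padicValRat_def, padicValInt.eq_zero_of_not_dvd hnum]
      ring
    have hℓ1 : (1 : ℝ) < ℓ := by exact_mod_cast hℓ.out.one_lt
    have hℓ0 : (0 : ℝ) < ℓ := by positivity
    have hxn : ‖(x : ℚ_[ℓ])‖ = (ℓ : ℝ) ^ (padicValNat ℓ x.den : ℤ) := by
      rw [Padic.norm_eq_zpow_neg_valuation hX0, hvx, neg_neg]
    have hvpos : 0 < padicValNat ℓ x.den :=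
      one_le_padicValNat_of_dvd x.den_nz hdvd
    have hx1 : 1 < ‖(x : ℚ_[ℓ])‖ := by
      rw [hxn]
      exact one_lt_zpow₀ hℓ1 (by exact_mod_cast hvpos)
    obtain ⟨hsq, hlt⟩ :=
      (W.baseChange ℚ_[ℓ]).norm_sq_eq_norm_cube (nonsingular_ratCast (p := ℓ) hxy).1 hx1
    have hY0 : (y : ℚ_[ℓ]) ≠ 0 := by
      intro h
      rw [h, norm_zero] at hlt
      linarith [norm_nonneg (x : ℚ_[ℓ])]
    rw [Padic.norm_eq_zpow_neg_valuation hY0, hxn, ← zpow_natCast, ← zpow_natCast, ← zpow_mul,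
      ← zpow_mul] at hsq
    have hinj := zpow_right_injective₀ hℓ0 hℓ1.ne' hsq
    simp only [Nat.cast_ofNat] at hinj
    -- `hinj : -(y-valuation) * 2 = v(den x) * 3`
    obtain ⟨k, hk⟩ : ∃ k : ℤ, (padicValNat ℓ x.den : ℤ) * 3 = 2 * k :=
      ⟨-(y : ℚ_[ℓ]).valuation, by linarith [hinj]⟩
    rw [Nat.even_iff]
    omega
  · rw [padicValNat.eq_zero_of_not_dvd hdvd]
    exact ⟨0, rfl⟩

/-- **`den x(P) = e²` is a perfect square** for every rational affine point of a globally minimal `W`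
(Mazur–Stein–Tate 2006 §1, p. 3: "any nonzero point `P = (x(P), y(P)) ∈ E(ℚ)` can be written uniquely in
the form `(a/d², b/d³)`, where `a, b, d ∈ ℤ`, `gcd(a, d) = gcd(b, d) = 1`, and `d > 0`"; Stein–Wuthrich's
`e(P)`): all prime exponents of `den x` are even (`even_padicValNat_den`) and a positive integer with even
exponents is a square (tree `KramerTwoDescent.nat_exists_sq_of_even_padicValNat`). The tree states it for a
globally minimal `W` (only `ℤ`-integrality is used). [cite: MazurSteinTate2006, §1 (p. 3) and Alg. 3.4 (step 2)]
[cite: SilvermanAEC2009, VII.2.2] -/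
theorem exists_den_eq_sq [W.IsElliptic] [W.IsGloballyMinimal] {x y : ℚ}
    (hxy : W.toAffine.Nonsingular x y) : ∃ e : ℕ, x.den = e ^ 2 :=
  KramerTwoDescent.nat_exists_sq_of_even_padicValNat x.den_pos fun ℓ hℓ =>
    haveI : Fact ℓ.Prime := ⟨hℓ⟩
    even_padicValNat_den hxy ℓ

/-! ### §5 At `p = 3`: `num x(P) ≡ 1 (mod 3)` -/

/-- **`num x(P) ≡ 1 (mod 3)`** (`x·den x = num x`): for a rational affine point `P = (x, y)` of a globally
minimal `W` with `‖x‖₃ > 1`, `‖x·den x(P) − 1‖₃ < 1`. With `den x = e²` (§4), `a = x e²` and `b = y e³`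
are `3`-adic units and `a³ = (x³/y²)·b²`; `x³/y² ≡ 1` (§3) and `b² ≡ 1`, `a² ≡ 1` (unit squares mod `3`)
give `a = a³/a² ≡ 1`. (At a general odd `p` the same computation only says that `num x(P)` is a
non-zero SQUARE mod `p`.) [cite: SilvermanAEC2009, VII.2.2] [cite: Serre1973, Ch. II §3.1 Prop. 7] -/
theorem norm_x_mul_den_sub_one_lt_one_three [W.IsElliptic] [W.IsGloballyMinimal] {x y : ℚ}
    (hxy : W.toAffine.Nonsingular x y) (hx : 1 < ‖(x : ℚ_[3])‖) :
    ‖(x : ℚ_[3]) * ((x.den : ℚ) : ℚ_[3]) - 1‖ < 1 := by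
  obtain ⟨e, he⟩ := exists_den_eq_sq hxy
  set X : ℚ_[3] := (x : ℚ_[3]) with hXdef
  set Y : ℚ_[3] := (y : ℚ_[3]) with hYdef
  have hd : ((x.den : ℚ) : ℚ_[3]) = (e : ℚ_[3]) ^ 2 := by
    rw [he]
    push_cast
    ring
  have heq : (W.baseChange ℚ_[3]).toAffine.Equation X Y := (nonsingular_ratCast (p := 3) hxy).left
  obtain ⟨hsq, hXY⟩ := (W.baseChange ℚ_[3]).norm_sq_eq_norm_cube heq hx
  have hXpos : 0 < ‖X‖ := one_pos.trans hx
  have hX0 : X ≠ 0 := norm_pos_iff.mp hXpos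
  have hY0 : Y ≠ 0 := by
    intro h
    rw [h, norm_zero] at hXY
    linarith [norm_nonneg X]
  have hdn : ‖((x.den : ℚ) : ℚ_[3])‖ = ‖X‖⁻¹ := norm_den_eq_inv_norm hx
  have he0 : (e : ℚ_[3]) ≠ 0 := by
    intro h0
    have : ((x.den : ℚ) : ℚ_[3]) = 0 := by rw [hd, h0, zero_pow two_ne_zero]
    exact absurd this (by exact_mod_cast x.den_nz)
  -- the two units `a = x e²`, `b = y e³`
  set A : ℚ_[3] := X * ((x.den : ℚ) : ℚ_[3]) with hAdef
  set b : ℚ_[3] := Y * (e : ℚ_[3]) ^ 3 with hbdef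
  have hA1 : ‖A‖ = 1 := by rw [hAdef, norm_mul, hdn, mul_inv_cancel₀ hXpos.ne']
  have hA0 : A ≠ 0 := norm_pos_iff.mp (by rw [hA1]; exact one_pos)
  have he2 : ‖(e : ℚ_[3])‖ ^ 2 = ‖X‖⁻¹ := by rw [← norm_pow, ← hd, hdn]
  have hb1 : ‖b‖ = 1 := by
    have h2 : ‖b‖ ^ 2 = 1 := by
      calc ‖b‖ ^ 2 = ‖Y‖ ^ 2 * (‖(e : ℚ_[3])‖ ^ 2) ^ 3 := by rw [hbdef, norm_mul, norm_pow]; ring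
        _ = ‖X‖ ^ 3 * (‖X‖⁻¹) ^ 3 := by rw [hsq, he2]
        _ = 1 := by rw [← mul_pow, mul_inv_cancel₀ hXpos.ne', one_pow]
    exact (pow_eq_one_iff_of_nonneg (norm_nonneg _) two_ne_zero).mp h2
  have hN : ‖X ^ 3 / Y ^ 2 - 1‖ < 1 := norm_pow_three_div_sq_sub_one_lt_one heq hx
  have hA3 : A ^ 3 = X ^ 3 / Y ^ 2 * b ^ 2 := by
    rw [hAdef, hbdef, hd, div_mul_eq_mul_div, eq_div_iff (pow_ne_zero 2 hY0)]
    ring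
  have hA3' : ‖A ^ 3 - 1‖ < 1 := by
    rw [hA3]
    exact norm_mul_sub_one_lt_one hN
      (Summit.BirchSwinnertonDyer.Rank1Residual.GaloisImage.LocalTorsion3.norm_sq_sub_one_lt_one hb1)
  have hA2 : ‖A ^ 2 - 1‖ < 1 :=
    Summit.BirchSwinnertonDyer.Rank1Residual.GaloisImage.LocalTorsion3.norm_sq_sub_one_lt_one hA1
  have hAeq : A = A ^ 3 / A ^ 2 := by
    rw [eq_div_iff (pow_ne_zero 2 hA0)]
    ring
  rw [hAeq]
  exact norm_div_sub_one_lt_one hA3' hA2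

end Summit.BirchSwinnertonDyer.Uniform.UI.O2

end
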